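import Mathlib
import Summits.Ventures.PercRepro2.PMK5Deg2Kernel

/-!
# The twelve-edge Kronecker certificate of the typed `K₃` base on an ARBITRARY seven-vertex skeleton
(blind cell PercRepro2, mine-2 g34; the shape of `PMK5Deg2Kernel.lean` (mine-2 g26, Theorem 27) with the graph
itself the parameter: the first seven-terminal kernel design of the cell)

The graph: seven vertices `o = 0, a₁ = 1, a₂ = 2, a₃ = 3, b = 4` (the five marks) and `u = 5, w = 6` (unmarked), and
twelve edges given by an arbitrary endpoint list `edge : Fin 12 → Fin 7 × Fin 7` — loops and parallel edges allowed
(a skeleton with fewer than twelve edges is one with a repeated edge at weight `0`).  Configurations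
`ω : Fin 12 → Bool`; connectivity on vertex bitmasks (`nb`, `step`, `reach` — six closure steps on seven vertices —
`conn`), all kernel-accelerated (`Nat.testBit` / `Nat.lor` / `Nat.shiftLeft`).

p1's eight-term kernel `K₃ = f₂f₁f₄ + f₁f₃f₅ − f₂f₁f₆ − f₂f₇f₈ − f₃f₇f₉ + f₂f₇f₁₀ − f₂f₁f₁₁ + f₁f₁₂f₃`
(`CovForm.K3`, `HCovCubic.lean`) splits on `Q = {a₁ ↮ a₂}` into ten positive and ten negative products of three
`0/1` tables exactly as in `PMK5Deg2Kernel.lean`, the tables now read on the seven-vertex graph `edge`.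

**Kronecker substitution** (the twelve-edge numbers of `Deg2`: `Deg2.kron`, `Deg2.KB = 2^24`, `Deg2.mask` — the
encoding is independent of the graph, only the tables change): a product of three encodings carries, digit by digit,
the typed three-copy class sums (`Deg2Kron.kronSum_mul_mul`); a digit is a sum of ten counts `≤ 3^12`, so `< 2^23`.

**The certificate** (`Cert edge`, one `decide +kernel` per skeleton): `kNeg ≤ kPos`, `Nat.land (kPos − kNeg) mask = 0`,
`Nat.land kNeg mask = 0` — `kPos ≥ kNeg` DIGITWISE: every typed three-copy class sum of `K₃` on the skeleton `edge`
is `≥ 0`, i.e. row 2′TRI (`CovForm.TypedBases`) on the skeleton, every typed edge set and pinning at once, hence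
(HCOV) for every weight vector (`SevenTyped.HCov_seven`).  No `native_decide`, no data file.
-/

namespace Summit.Ventures.PercRepro2

namespace Seven

/-! ## The graph and bitmask connectivity on seven vertices -/

/-- First endpoint of edge `e`, as a number. -/
def ea (edge : Fin 12 → Fin 7 × Fin 7) (e : Fin 12) : ℕ := ((edge e).1 : ℕ)

/-- Second endpoint of edge `e`, as a number. -/
def eb (edge : Fin 12 → Fin 7 × Fin 7) (e : Fin 12) : ℕ := ((edge e).2 : ℕ)

/-- The neighbour bitmask of the vertex `u` in the open subgraph of `ω`. -/
def nb (edge : Fin 12 → Fin 7 × Fin 7) (ω : Fin 12 → Bool) (u : ℕ) : ℕ :=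
  (List.finRange 12).foldl (fun acc e =>
    if ω e then
      (if ea edge e = u then acc ||| (1 <<< eb edge e) else if eb edge e = u then acc ||| (1 <<< ea edge e)
        else acc)
    else acc) 0

/-- One closure step on a vertex bitmask: add the open neighbours of every vertex of `R`. -/
def step (edge : Fin 12 → Fin 7 × Fin 7) (ω : Fin 12 → Bool) (R : ℕ) : ℕ :=
  (List.range 7).foldl (fun acc v => if R.testBit v then acc ||| nb edge ω v else acc) R

/-- The vertices reached from `u` (six steps suffice on seven vertices). -/
def reach (edge : Fin 12 → Fin 7 × Fin 7) (ω : Fin 12 → Bool) (u : ℕ) : ℕ :=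
  step edge ω (step edge ω (step edge ω (step edge ω (step edge ω (step edge ω (1 <<< u))))))

/-- Computable connectivity `u ↔ v` in the open subgraph of `ω`. -/
def conn (edge : Fin 12 → Fin 7 × Fin 7) (ω : Fin 12 → Bool) (u v : ℕ) : Bool := (reach edge ω u).testBit v

/-! ## The side tables (marks `o = 0, a₁ = 1, a₂ = 2, a₃ = 3, b = 4`) -/

/-- `Q = {a₁ ↮ a₂}`. -/
def tQ (edge : Fin 12 → Fin 7 × Fin 7) (ω : Fin 12 → Bool) : Bool := !conn edge ω 1 2
/-- `L_v = {v ∈ C₁}`: `v` joined to `a₁ = 1`. -/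
def tL (edge : Fin 12 → Fin 7 × Fin 7) (v : ℕ) (ω : Fin 12 → Bool) : Bool := conn edge ω 1 v
/-- `H_v = {v ∈ C₂}`: `v` joined to `a₂ = 2`. -/
def tH (edge : Fin 12 → Fin 7 × Fin 7) (v : ℕ) (ω : Fin 12 → Bool) : Bool := conn edge ω 2 v
/-- `U_v = {v ∈ C₁ ∪ C₂}`. -/
def tU (edge : Fin 12 → Fin 7 × Fin 7) (v : ℕ) (ω : Fin 12 → Bool) : Bool := tL edge v ω || tH edge v ω
/-- `u` and `v` on the same side: the positive part of `σ_u σ_v`. -/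
def tSame (edge : Fin 12 → Fin 7 × Fin 7) (u v : ℕ) (ω : Fin 12 → Bool) : Bool :=
  (tL edge u ω && tL edge v ω) || (tH edge u ω && tH edge v ω)
/-- `u` and `v` on opposite sides: the negative part of `σ_u σ_v`. -/
def tOpp (edge : Fin 12 → Fin 7 × Fin 7) (u v : ℕ) (ω : Fin 12 → Bool) : Bool :=
  (tL edge u ω && tH edge v ω) || (tH edge u ω && tL edge v ω)
/-- `PD = Q ∩ {a₃ ∉ C₁ ∪ C₂}`. -/
def tPD (edge : Fin 12 → Fin 7 × Fin 7) (ω : Fin 12 → Bool) : Bool :=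
  tQ edge ω && !tL edge 3 ω && !tH edge 3 ω
/-- `PD ∩ {o ∈ C₁ ∪ C₂}` (`f₃`). -/
def tPDoU (edge : Fin 12 → Fin 7 × Fin 7) (ω : Fin 12 → Bool) : Bool := tPD edge ω && tU edge 0 ω

/-! ## The tables of the twelve functions -/

/-- `f₄⁺ = 1_Q 1_{o, b same side}`. -/
def t4p (edge : Fin 12 → Fin 7 × Fin 7) (ω : Fin 12 → Bool) : Bool := tQ edge ω && tSame edge 0 4 ω
/-- `f₄⁻ = 1_Q 1_{o, b opposite}`. -/
def t4m (edge : Fin 12 → Fin 7 × Fin 7) (ω : Fin 12 → Bool) : Bool := tQ edge ω && tOpp edge 0 4 ω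
/-- `f₅⁺ = 1_Q 1_{a₃, b same side}`. -/
def t5p (edge : Fin 12 → Fin 7 × Fin 7) (ω : Fin 12 → Bool) : Bool := tQ edge ω && tSame edge 3 4 ω
/-- `f₅⁻ = 1_Q 1_{a₃, b opposite}`. -/
def t5m (edge : Fin 12 → Fin 7 × Fin 7) (ω : Fin 12 → Bool) : Bool := tQ edge ω && tOpp edge 3 4 ω
/-- `f₆⁺ = 1_Q 1_{o∈U} 1_{a₃, b same side}`. -/
def t6p (edge : Fin 12 → Fin 7 × Fin 7) (ω : Fin 12 → Bool) : Bool :=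
  tQ edge ω && tU edge 0 ω && tSame edge 3 4 ω
/-- `f₆⁻ = 1_Q 1_{o∈U} 1_{a₃, b opposite}`. -/
def t6m (edge : Fin 12 → Fin 7 × Fin 7) (ω : Fin 12 → Bool) : Bool :=
  tQ edge ω && tU edge 0 ω && tOpp edge 3 4 ω
/-- `f₇⁺` at `v`: `1_Q 1_{v∈C₁}` (`f₇` at `b = 4`, `f₈` at `o = 0`, `f₉` at `a₃ = 3`). -/
def t7p (edge : Fin 12 → Fin 7 × Fin 7) (v : ℕ) (ω : Fin 12 → Bool) : Bool := tQ edge ω && tL edge v ω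
/-- `f₇⁻` at `v`: `1_Q 1_{v∈C₂}`. -/
def t7m (edge : Fin 12 → Fin 7 × Fin 7) (v : ℕ) (ω : Fin 12 → Bool) : Bool := tQ edge ω && tH edge v ω
/-- `f₁₀⁺ = 1_Q 1_{a₃∈C₁} 1_{o∈U}`. -/
def t10p (edge : Fin 12 → Fin 7 × Fin 7) (ω : Fin 12 → Bool) : Bool :=
  tQ edge ω && tL edge 3 ω && tU edge 0 ω
/-- `f₁₀⁻ = 1_Q 1_{a₃∈C₂} 1_{o∈U}`. -/
def t10m (edge : Fin 12 → Fin 7 × Fin 7) (ω : Fin 12 → Bool) : Bool :=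
  tQ edge ω && tH edge 3 ω && tU edge 0 ω
/-- `f₁₁ = 1_PD 1_{o∈U} 1_{b∈U}`. -/
def t11 (edge : Fin 12 → Fin 7 × Fin 7) (ω : Fin 12 → Bool) : Bool :=
  tPD edge ω && tU edge 0 ω && tU edge 4 ω
/-- `f₁₂ = 1_PD 1_{b∈U}`. -/
def t12 (edge : Fin 12 → Fin 7 × Fin 7) (ω : Fin 12 → Bool) : Bool := tPD edge ω && tU edge 4 ω

/-! ## Kronecker numbers and the certificate (the twelve-edge encoding of `Deg2`) -/

/-- The positive part of `K₃` on the skeleton (ten products, in the order `x, y, w` of the factors):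
`f₂f₁f₄⁺ + f₁f₃f₅⁺ + f₂f₁f₆⁻ + f₂f₇⁺f₈⁻ + f₂f₇⁻f₈⁺ + f₃f₇⁺f₉⁻ + f₃f₇⁻f₉⁺ + f₂f₇⁺f₁₀⁺ + f₂f₇⁻f₁₀⁻ + f₁f₁₂f₃`. -/
def kPos (edge : Fin 12 → Fin 7 × Fin 7) : ℕ :=
  Deg2.kron (tPD edge) * Deg2.kron (tQ edge) * Deg2.kron (t4p edge) +
    Deg2.kron (tQ edge) * Deg2.kron (tPDoU edge) * Deg2.kron (t5p edge) +
    Deg2.kron (tPD edge) * Deg2.kron (tQ edge) * Deg2.kron (t6m edge) +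
    Deg2.kron (tPD edge) * Deg2.kron (t7p edge 4) * Deg2.kron (t7m edge 0) +
    Deg2.kron (tPD edge) * Deg2.kron (t7m edge 4) * Deg2.kron (t7p edge 0) +
    Deg2.kron (tPDoU edge) * Deg2.kron (t7p edge 4) * Deg2.kron (t7m edge 3) +
    Deg2.kron (tPDoU edge) * Deg2.kron (t7m edge 4) * Deg2.kron (t7p edge 3) +
    Deg2.kron (tPD edge) * Deg2.kron (t7p edge 4) * Deg2.kron (t10p edge) +
    Deg2.kron (tPD edge) * Deg2.kron (t7m edge 4) * Deg2.kron (t10m edge) +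
    Deg2.kron (tQ edge) * Deg2.kron (t12 edge) * Deg2.kron (tPDoU edge)

/-- The negative part of `K₃` on the skeleton (ten products):
`f₂f₁f₄⁻ + f₁f₃f₅⁻ + f₂f₁f₆⁺ + f₂f₇⁺f₈⁺ + f₂f₇⁻f₈⁻ + f₃f₇⁺f₉⁺ + f₃f₇⁻f₉⁻ + f₂f₇⁺f₁₀⁻ + f₂f₇⁻f₁₀⁺ + f₂f₁f₁₁`. -/
def kNeg (edge : Fin 12 → Fin 7 × Fin 7) : ℕ :=
  Deg2.kron (tPD edge) * Deg2.kron (tQ edge) * Deg2.kron (t4m edge) +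
    Deg2.kron (tQ edge) * Deg2.kron (tPDoU edge) * Deg2.kron (t5m edge) +
    Deg2.kron (tPD edge) * Deg2.kron (tQ edge) * Deg2.kron (t6p edge) +
    Deg2.kron (tPD edge) * Deg2.kron (t7p edge 4) * Deg2.kron (t7p edge 0) +
    Deg2.kron (tPD edge) * Deg2.kron (t7m edge 4) * Deg2.kron (t7m edge 0) +
    Deg2.kron (tPDoU edge) * Deg2.kron (t7p edge 4) * Deg2.kron (t7p edge 3) +
    Deg2.kron (tPDoU edge) * Deg2.kron (t7m edge 4) * Deg2.kron (t7m edge 3) +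
    Deg2.kron (tPD edge) * Deg2.kron (t7p edge 4) * Deg2.kron (t10m edge) +
    Deg2.kron (tPD edge) * Deg2.kron (t7m edge 4) * Deg2.kron (t10p edge) +
    Deg2.kron (tPD edge) * Deg2.kron (tQ edge) * Deg2.kron (t11 edge)

/-- **The certificate shape**: `kNeg ≤ kPos` and the two mask tests (no borrow anywhere, digits of `kNeg`
below `2^23`). -/
def Cert (edge : Fin 12 → Fin 7 × Fin 7) : Prop :=
  kNeg edge ≤ kPos edge ∧ Nat.land (kPos edge - kNeg edge) Deg2.mask = 0 ∧
    Nat.land (kNeg edge) Deg2.mask = 0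

end Seven

end Summit.Ventures.PercRepro2
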